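import Summits.Ventures.PercRepro.RankDistMinorBottom

/-!
# PercRepro — the cumulative shadow inequality under the deletion of a loop; the lossy one-step (p9, gen 18)

Companion of `RankDistMinor` (free elements) and `RankDistColoop` (coloops). A LOOP `e` doubles every level of the
upper shadow of the bottom family (`card_shadowLev_of_isLoop`: `s_u(M) = 2·s_u(M ∖ e)`; the bottom sets of
`M ∖ e` are the bottom sets of `M` avoiding `e`, `mem_Uq_delete_iff_of_isLoop`, and removing a loop from a bottom
set leaves a bottom set, `erase_mem_Uq_of_isLoop`), so `ShadowCumulative` transfers from `M ∖ e`
(`shadowCumulative_of_isLoop`). Also here: `shadowLev_eq_empty_of_lt` (no rank-`u` set contains a bottom set of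
rank `q > u`) and the LOSSY one-step `card_shadowLev_le_succ_mul` — below the rank of `M`, `s_u ≤ (u+1)·s_{u+1}`
for the shadow of any family (every shadow set at level `u` has a rank-increasing element, every set at level
`u + 1` has at most `u + 1` shadow-coloops; from `sum_shadowWeight_le`). Nothing here is a statement about any
window of the crux.
-/
namespace PercRepro.RankDist

open Set Finset Matroid PercRepro.ThmH

variable {α : Type} [DecidableEq α] (M : Matroid α) [M.Finite]

/-- No rank-`u` set contains a bottom set of rank `q > u`. -/
lemma shadowLev_eq_empty_of_lt {p q u : ℕ} (hu : u < q) : shadowLev M u (PerFlat.Uq M p q) = ∅ := by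
  ext A
  simp only [Finset.notMem_empty, iff_false]
  intro hA
  rw [mem_shadowLev] at hA
  obtain ⟨hAE, hAu, B, hB, hBA⟩ := hA
  rw [PerFlat.mem_Uq] at hB
  have h1 : M.eRk (B : Set α) ≤ M.eRk A := M.eRk_mono hBA
  rw [hB.2.1, eRk_eq_coe_rk M hAE, hAu] at h1
  have h2 : q ≤ u := by exact_mod_cast h1
  omega

omit [DecidableEq α] in
/-- **The lossy one-step**: below the rank of `M`, `s_u ≤ (u + 1)·s_{u+1}` for the shadow of any family. -/
theorem card_shadowLev_le_succ_mul (𝒜 : Finset (Finset α)) {u : ℕ} (hu : (u : ℕ∞) < M.eRank) :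
    (shadowLev M u 𝒜).card ≤ (u + 1) * (shadowLev M (u + 1) 𝒜).card := by
  have hsum := sum_shadowWeight_le M 𝒜 u
  -- every shadow set at level `u` has weight at least `1/(u+1)`
  have hlow : ∀ A ∈ shadowLev M u 𝒜, (1 : ℚ) / (u + 1) ≤ shadowWeight M 𝒜 u A := by
    intro A hA
    rw [mem_shadowLev] at hA
    obtain ⟨hAE, hAu, hAB⟩ := hA
    have hrk : M.eRk A < M.eRank := by rw [eRk_eq_coe_rk M hAE, hAu]; exact hu
    obtain ⟨e, heE, hecl⟩ := exists_notMem_closure M hrk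
    have he : e ∈ extSet M A := by
      rw [mem_extSet]; exact ⟨heE, Matroid.eRk_insert_eq_add_one ⟨heE, hecl⟩⟩
    have heA : e ∉ A := fun h => hecl (M.subset_closure A hAE h)
    unfold shadowWeight
    have hterm : (1 : ℚ) / (u + 1) ≤
        (1 : ℚ) / ((dropSetIn M (shadowLev M u 𝒜) (insert e A) u).card : ℚ) := by
      have hcard : (dropSetIn M (shadowLev M u 𝒜) (insert e A) u).card ≤ u + 1 := by
        refine (Finset.card_filter_le _ _).trans ?_
        apply card_dropSet_le M (Set.insert_subset heE hAE)
        rw [rk_eq_iff M (Set.insert_subset heE hAE), Matroid.eRk_insert_eq_add_one ⟨heE, hecl⟩,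
          eRk_eq_coe_rk M hAE, hAu]
        push_cast; rfl
      have hpos : (0 : ℚ) < ((dropSetIn M (shadowLev M u 𝒜) (insert e A) u).card : ℚ) := by
        have hmem : e ∈ dropSetIn M (shadowLev M u 𝒜) (insert e A) u := by
          rw [mem_dropSetIn, mem_dropSet]
          refine ⟨⟨heE, mem_insert e A, ?_⟩, ?_⟩
          · rw [Set.insert_sdiff_of_mem _ (mem_singleton e), sdiff_singleton_eq_self heA]; exact hAu
          · rw [Set.insert_sdiff_of_mem _ (mem_singleton e), sdiff_singleton_eq_self heA]
            rw [mem_shadowLev]; exact ⟨hAE, hAu, hAB⟩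
        exact_mod_cast Finset.card_pos.2 ⟨e, hmem⟩
      apply one_div_le_one_div_of_le hpos
      exact_mod_cast hcard
    calc (1 : ℚ) / (u + 1) ≤ (1 : ℚ) / ((dropSetIn M (shadowLev M u 𝒜) (insert e A) u).card : ℚ) := hterm
      _ ≤ ∑ e' ∈ extSet M A, (1 : ℚ) / ((dropSetIn M (shadowLev M u 𝒜) (insert e' A) u).card : ℚ) :=
          Finset.single_le_sum (f := fun e' => (1 : ℚ) / ((dropSetIn M (shadowLev M u 𝒜) (insert e' A) u).card : ℚ))
            (fun e' _ => by positivity) he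
  have hsum2 : ((shadowLev M u 𝒜).card : ℚ) * (1 / (u + 1)) ≤ ((shadowLev M (u + 1) 𝒜).card : ℚ) := by
    calc ((shadowLev M u 𝒜).card : ℚ) * (1 / (u + 1))
        = ∑ A ∈ shadowLev M u 𝒜, (1 : ℚ) / (u + 1) := by rw [Finset.sum_const, nsmul_eq_mul]
      _ ≤ ∑ A ∈ shadowLev M u 𝒜, shadowWeight M 𝒜 u A := Finset.sum_le_sum hlow
      _ ≤ _ := hsum
  have hu1 : (0 : ℚ) < u + 1 := by positivity
  rw [mul_one_div, div_le_iff₀ hu1] at hsum2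
  exact_mod_cast (by linarith : ((shadowLev M u 𝒜).card : ℚ) ≤ ((u : ℚ) + 1) * (shadowLev M (u + 1) 𝒜).card)

/-! ### Loops -/

/-- For a loop `e`, the bottom sets of `M ∖ e` are the bottom sets of `M` avoiding `e`. -/
lemma mem_Uq_delete_iff_of_isLoop {p q : ℕ} {e : α} (he : M.IsLoop e) {B : Finset α} :
    B ∈ PerFlat.Uq (M.delete {e}) p q ↔ B ∈ PerFlat.Uq M p q ∧ e ∉ B := by
  rw [PerFlat.mem_Uq, PerFlat.mem_Uq, gr_delete]
  have hcoe : ∀ B : Finset α, (((gr M).erase e \ B : Finset α) : Set α) = M.E \ insert e (B : Set α) := by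
    intro B; rw [Finset.coe_sdiff, Finset.coe_erase, coe_gr, Set.sdiff_sdiff, Set.insert_eq]
  have hrk : ∀ B : Finset α, M.eRk (M.E \ insert e (B : Set α)) = M.eRk (M.E \ (B : Set α)) := by
    intro B
    have h1 : M.E \ (B : Set α) ⊆ insert e (M.E \ insert e (B : Set α)) := by
      intro x hx
      by_cases hxe : x = e
      · exact Or.inl hxe
      · exact Or.inr ⟨hx.1, fun hh => hh.elim hxe hx.2⟩
    apply le_antisymm
    · exact M.eRk_mono (Set.sdiff_subset_sdiff_right (Set.subset_insert _ _))
    · calc M.eRk (M.E \ (B : Set α)) ≤ M.eRk (insert e (M.E \ insert e (B : Set α))) := M.eRk_mono h1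
        _ = M.eRk (M.E \ insert e (B : Set α)) := eRk_insert_eq_of_mem_closure M (he.mem_closure _)
  constructor
  · rintro ⟨hB, hBq, hBp⟩
    have hBe : e ∉ B := fun hh => (Finset.mem_erase.1 (hB hh)).1 rfl
    have hBE : (B : Set α) ⊆ M.E \ {e} := by
      rw [← coe_gr, ← Finset.coe_erase]; exact_mod_cast hB
    rw [deleteElem_eRk_eq M hBE] at hBq
    rw [hcoe, deleteElem_eRk_eq M (Set.sdiff_subset_sdiff_right (Set.singleton_subset_iff.2 (Set.mem_insert _ _))),
      hrk] at hBp
    refine ⟨⟨fun x hx => (Finset.mem_erase.1 (hB hx)).2, hBq, ?_⟩, hBe⟩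
    rwa [Finset.coe_sdiff, coe_gr]
  · rintro ⟨⟨hB, hBq, hBp⟩, hBe⟩
    have hBE : (B : Set α) ⊆ M.E \ {e} := by
      intro x hx
      exact ⟨by rw [← coe_gr]; exact_mod_cast hB hx,
        fun hh => hBe (by rw [mem_singleton_iff] at hh; rw [← hh]; exact hx)⟩
    refine ⟨fun x hx => Finset.mem_erase.2 ⟨fun hh => hBe (hh ▸ hx), hB hx⟩, ?_, ?_⟩
    · rw [deleteElem_eRk_eq M hBE]; exact hBq
    · rw [hcoe, deleteElem_eRk_eq M (Set.sdiff_subset_sdiff_right (Set.singleton_subset_iff.2 (Set.mem_insert _ _))),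
        hrk]
      rwa [Finset.coe_sdiff, coe_gr] at hBp

/-- Removing a loop from a bottom set leaves a bottom set. -/
lemma erase_mem_Uq_of_isLoop {p q : ℕ} {e : α} (he : M.IsLoop e) {B : Finset α}
    (hB : B ∈ PerFlat.Uq M p q) : B.erase e ∈ PerFlat.Uq M p q := by
  by_cases heB : e ∈ B
  · rw [PerFlat.mem_Uq] at hB ⊢
    obtain ⟨hBg, hBq, hBp⟩ := hB
    refine ⟨(Finset.erase_subset e B).trans hBg, ?_, ?_⟩
    · rw [Finset.coe_erase, ← hBq, ← eRk_insert_eq_of_mem_closure M (he.mem_closure ((B : Set α) \ {e})),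
        Set.insert_sdiff_singleton, Set.insert_eq_of_mem heB]
    · rw [Finset.coe_sdiff, coe_gr] at hBp
      rw [Finset.coe_sdiff, coe_gr, Finset.coe_erase, ← hBp]
      have h1 : M.E \ ((B : Set α) \ {e}) = insert e (M.E \ (B : Set α)) := by
        ext x
        simp only [Set.mem_sdiff, Set.mem_insert_iff, Set.mem_singleton_iff, not_and, not_not]
        constructor
        · rintro ⟨hxE, hx⟩
          by_cases hxe : x = e
          · exact Or.inl hxe
          · exact Or.inr ⟨hxE, fun hxB => hxe (hx hxB)⟩
        · rintro (rfl | ⟨hxE, hxB⟩)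
          · exact ⟨he.mem_ground, fun _ => rfl⟩
          · exact ⟨hxE, fun hh => absurd hh hxB⟩
      rw [h1, eRk_insert_eq_of_mem_closure M (he.mem_closure _)]
  · rw [Finset.erase_eq_of_notMem heB]; exact hB

open scoped Classical in
/-- **A loop doubles every level of the shadow.** -/
theorem card_shadowLev_of_isLoop {p q u : ℕ} {e : α} (he : M.IsLoop e) :
    (shadowLev M u (PerFlat.Uq M p q)).card
      = 2 * (shadowLev (M.delete {e}) u (PerFlat.Uq (M.delete {e}) p q)).card := by
  have heE : e ∈ M.E := he.mem_ground
  -- the members avoiding `e` form the shadow of `M ∖ e`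
  have h0 : (shadowLev M u (PerFlat.Uq M p q)).filter (fun A => e ∉ A)
      = shadowLev (M.delete {e}) u (PerFlat.Uq (M.delete {e}) p q) := by
    ext A
    rw [Finset.mem_filter, mem_shadowLev, mem_shadowLev, Matroid.delete_ground]
    constructor
    · rintro ⟨⟨hAE, hAu, B, hB, hBA⟩, heA⟩
      have hAE' : A ⊆ M.E \ {e} := Set.subset_sdiff.2 ⟨hAE, Set.disjoint_singleton_right.2 heA⟩
      refine ⟨hAE', ?_, B, (mem_Uq_delete_iff_of_isLoop M he).2 ⟨hB, fun hh => heA (hBA hh)⟩, hBA⟩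
      have hAE'' : A ⊆ (M.delete {e}).E := by rw [Matroid.delete_ground]; exact hAE'
      rw [rk_eq_iff (M.delete {e}) hAE'', deleteElem_eRk_eq M hAE', ← rk_eq_iff M hAE]
      exact hAu
    · rintro ⟨hAE', hAu, B, hB, hBA⟩
      have heA : e ∉ A := fun hh => (hAE' hh).2 rfl
      have hAE : A ⊆ M.E := hAE'.trans Set.sdiff_subset
      refine ⟨⟨hAE, ?_, B, ((mem_Uq_delete_iff_of_isLoop M he).1 hB).1, hBA⟩, heA⟩
      have hAE'' : A ⊆ (M.delete {e}).E := by rw [Matroid.delete_ground]; exact hAE'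
      rw [rk_eq_iff (M.delete {e}) hAE'', deleteElem_eRk_eq M hAE', ← rk_eq_iff M hAE] at hAu
      exact hAu
  -- the members through `e` are in bijection with those avoiding `e`
  have h1 : ((shadowLev M u (PerFlat.Uq M p q)).filter (fun A => e ∈ A)).card
      = ((shadowLev M u (PerFlat.Uq M p q)).filter (fun A => e ∉ A)).card := by
    apply Finset.card_bij (fun A _ => A \ {e})
    · intro A hA
      rw [Finset.mem_filter, mem_shadowLev] at hA ⊢
      obtain ⟨⟨hAE, hAu, B, hB, hBA⟩, heA⟩ := hA
      refine ⟨⟨Set.sdiff_subset.trans hAE, ?_, B.erase e, erase_mem_Uq_of_isLoop M he hB, ?_⟩,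
        fun hh => hh.2 rfl⟩
      · rw [rk_eq_iff M (Set.sdiff_subset.trans hAE), ← eRk_insert_eq_of_mem_closure M (he.mem_closure (A \ {e})),
          Set.insert_sdiff_singleton, Set.insert_eq_of_mem heA, ← rk_eq_iff M hAE]
        exact hAu
      · rw [Finset.coe_erase]; exact Set.sdiff_subset_sdiff_left hBA
    · intro A hA A' hA' hAA'
      rw [Finset.mem_filter] at hA hA'
      rw [← insert_eq_of_mem hA.2, ← insert_eq_of_mem hA'.2, ← Set.insert_sdiff_singleton,
        ← Set.insert_sdiff_singleton (s := A'), hAA']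
    · intro A'' hA''
      rw [Finset.mem_filter, mem_shadowLev] at hA''
      obtain ⟨⟨hA''E, hA''u, B, hB, hBA⟩, heA''⟩ := hA''
      refine ⟨insert e A'', ?_, ?_⟩
      · rw [Finset.mem_filter, mem_shadowLev]
        refine ⟨⟨insert_subset heE hA''E, ?_, B, hB, hBA.trans (subset_insert _ _)⟩, mem_insert e A''⟩
        rw [rk_eq_iff M (insert_subset heE hA''E), eRk_insert_eq_of_mem_closure M (he.mem_closure _),
          ← rk_eq_iff M hA''E]
        exact hA''u
      · rw [Set.insert_sdiff_of_mem _ (mem_singleton e), sdiff_singleton_eq_self heA'']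
  have key := Finset.card_filter_add_card_filter_not (fun A => e ∈ A) (s := shadowLev M u (PerFlat.Uq M p q))
  rw [← h0, ← key, h1, two_mul]

/-- **(SC) is inherited from `M ∖ e` for a loop `e`.** -/
theorem shadowCumulative_of_isLoop {p q : ℕ} {e : α} (he : M.IsLoop e)
    (hD : ShadowCumulative (M.delete {e}) p q) : ShadowCumulative M p q := by
  intro u hqu hup
  rw [card_shadowLev_of_isLoop M he, card_shadowLev_of_isLoop M he]
  have := hD u hqu hup
  calc 2 * (shadowLev (M.delete {e}) q (PerFlat.Uq (M.delete {e}) p q)).card * (p + q).choose u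
      = 2 * ((shadowLev (M.delete {e}) q (PerFlat.Uq (M.delete {e}) p q)).card * (p + q).choose u) := by ring
    _ ≤ 2 * ((shadowLev (M.delete {e}) u (PerFlat.Uq (M.delete {e}) p q)).card * (p + q).choose q) :=
        Nat.mul_le_mul_left 2 this
    _ = 2 * (shadowLev (M.delete {e}) u (PerFlat.Uq (M.delete {e}) p q)).card * (p + q).choose q := by ring

end PercRepro.RankDist
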